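import Literature.IUT.HodgeTheaters.InitialThetaDataTripod
import Literature.IUT.HodgeTheaters.ImageContainsSL2Bridge
import Literature.IUT.LogVolume.Corollary22CondP6Transport
import Literature.IUT.LogVolume.Corollary22CondP6Five
import HarnessLib

/-!
# (P6) for the model `E_F = W ×_{F_mod} F` of [IUTchIV] Thm. 1.10 from `Cor22.CondP6` — the Galois-image
# clause of [IUTchI] Def. 3.1 (c) for the cell's (P7)-constructor, discharged

Mochizuki, *Inter-universal Teichmüller theory IV*, RIMS manuscript (Apr. 2020; = PRIMS **57** (2021)),
Cor. 2.2 (ii), proof p. 46: "(P6) the image of the outer homomorphism `Gal(Q̄/F) → GL₂(𝔽_l)` determined by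
the `l`-torsion points of `E_F` contains the subgroup `SL₂(𝔽_l) ⊆ GL₂(𝔽_l)`. … (P7) … if one takes … the
“`X_F`” of [IUTchI], Definition 3.1, to be the once-punctured elliptic curve associated to `E_F` … then there
exist data … such that all of the conditions of [IUTchI], Definition 3.1, (a), (b), (c), (d), (e), (f), are
satisfied"; Thm. 1.10 p. 22: `F := F_mod(√−1, E_{F_mod}[2·3·5])` for a model `E_{F_mod}` over `F_mod`
(Prop. 1.8 (ii), (iii)); [IUTchI] Def. 3.1 (c): "the image of the outer homomorphism `G_F → GL₂(𝔽_l)` …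
contains the subgroup `SL₂(𝔽_l)`".

PROOF-ONLY file (theorems only; no definitions, no named facts).  In the cell's typing the (P7)-constructor
(`exists_initialThetaData_ofModel` / `…_ofPlaceInput` / `…_of_conditions`, abc-iut-L5-t7) builds the initial
Θ-data on the MODEL `modelCurve (modCurve P) = ofJ(j(λ)) ⊗ F` over the model theta field
`F = ThetaF (modCurve P) = F_mod(√−1, W[2·3·5])` (`InitialThetaDataTripod.lean`: `F_tpd ↪ F` by `tpdEmb`,
`F/F_tpd` Galois, `l ∤ [F : F_tpd]` for `l ≥ 7`, `j(E_F) = j(λ)`), and asks for Def. 3.1 (c)'s `SL₂`-clause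
there — `BadPlaceInput.imageContainsSL2` / `PlaceInput.imageContainsSL2`, or (P4) `¬ AdmitsLCyclic` for
`exists_initialThetaData_of_conditions` — whereas the interface `Cor22.Thm110Legendre` supplies (P6) in the
form `Cor22.CondP6 P l` (for the LEGENDRE curve over the theta-fields `F_tpd(√−1, E[3·5])`).  Here the gap is
closed from the tree's transport theorems (`Cor22.imageModLContainsSL2_of_condP6`, abc-iut-S5):

* `seven_le_of_condP6` — `CondP6 P l` with `l ≥ 5` prime forces `l ≥ 7` (at `l = 5` the image on
  `E[5] ⊆ E(F)` is trivial: `Cor22.not_condP6_five_of_isThetaField` + `Cor22.exists_isThetaField`; Thm. 1.10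
  p. 22 "`l ≠ 5`");
* `imageModLContainsSL2_modelCurve_of_condP6` — `Cor22.CondP6 P l` ⟹ `SL₂(𝔽_l) ⊆` the image of
  `Gal(F̄/F)` on `(modelCurve (modCurve P))[l]` ([GenEll] form `EllPoint.ImageModLContainsSL2`);
* `imageContainsSL2_modelCurve_of_condP6` — the same in the typing of [IUTchI] Def. 3.1 (c)
  (`ImageContainsSL2`, via abc-iut-L5-t12's bridge) = the field `BadPlaceInput.imageContainsSL2`;
* `not_admitsLCyclic_modelCurve_of_condP6` — (P4) for the model = the hypothesis `hno` of
  `exists_initialThetaData_of_conditions`.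

So the layer-2 stub `ThetaDataExistsAt P l` of the crux `ThetaPartII`, quantified exactly as
`Cor22.Thm110Legendre` binds (`AdmitsCore → CondP2 → CondP5 → CondP6 → …`), meets the (P7)-constructor with
no restated (P6).  Classical throughout; TAKES NO SIDE on [IUTchIII] Cor. 3.12.
-/

noncomputable section

open scoped Classical

namespace Literature.IUT.LogVolume.Cor22

open Literature.NumberTheory.DiophantineGeometry.GenEll

/-- **`l ≠ 5`** (Thm. 1.10 p. 22): if `Cor22.CondP6 P l` holds for a prime `l ≥ 5` then `l ≥ 7`, because a
theta-field `F ⊇ F_tpd` exists (`exists_isThetaField`) and over it (P6) fails at `l = 5`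
(`not_condP6_five_of_isThetaField`: `E[5] ⊆ E(F)`). [cite: Mochizuki2012, IUTchIV Thm 1.10 p.22] -/
theorem seven_le_of_condP6 {P : NFPoint} (hU : P.InU) {l : ℕ} (hl : l.Prime) (h5 : 5 ≤ l)
    (h6 : CondP6 P l) : 7 ≤ l := by
  by_contra hlt
  have hl5 : l = 5 := by
    rcases Nat.lt_or_ge l 6 with h | h
    · omega
    · exfalso
      have h6' : l = 6 := by omega
      rw [h6'] at hl
      exact absurd hl (by decide)
  subst hl5
  obtain ⟨F, hNF, hF⟩ := exists_isThetaField (P := P) hU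
  haveI := hNF
  exact not_condP6_five_of_isThetaField hU F hF h6

end Literature.IUT.LogVolume.Cor22

namespace Literature.IUT.HodgeTheaters

open Literature.NumberTheory.DiophantineGeometry.GenEll Literature.IUT.LogVolume
open Literature.NumberTheory.DiophantineGeometry

section Tripod

variable (P : NFPoint)

/-- **(P6) for the model from `Cor22.CondP6`** ([IUTchIV] Cor. 2.2 (ii) (P6)–(P7) p. 46 with Thm. 1.10 p. 22):
for `λ ∈ U_X` minimally presented (`P ∈ UP`) with an `F`-core (`Cor22.AdmitsCore P`: `j ∉ {0, 1728}`) and a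
prime `l ≥ 5` with `Cor22.CondP6 P l`, the image of `Gal(F̄/F)` on the `l`-torsion of the model
`E_F = modelCurve (modCurve P)` over the model theta field `F = ThetaF (modCurve P) ⊇ F_tpd` contains
`SL₂(𝔽_l)` (`F/F_tpd` Galois with `l ∤ [F:F_tpd]`, `j(E_F) = j(λ)`: `InitialThetaDataTripod.lean`; transport
`Cor22.imageModLContainsSL2_of_condP6`). [cite: Mochizuki2012, IUTchIV Cor. 2.2 (ii) (P6)–(P7) p.46] -/
theorem imageModLContainsSL2_modelCurve_of_condP6 (hP : P ∈ UP) (hcore : Cor22.AdmitsCore P) {l : ℕ}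
    [Fact l.Prime] (h5 : 5 ≤ l) (h6 : Cor22.CondP6 P l) :
    ({ F := ThetaF (modCurve P), W := modelCurve (modCurve P) } : EllPoint).ImageModLContainsSL2 l := by
  have hl : l.Prime := Fact.out
  have h7 : 7 ≤ l := Cor22.seven_le_of_condP6 hP.1 hl h5 h6
  letI := tpdAlgebra P hP
  haveI := isGalois_tpd P hP
  exact Cor22.imageModLContainsSL2_of_condP6 hP.1 hcore h5 h6 (ThetaF (modCurve P))
    (not_dvd_finrank_tpd P hP hl h7) (modelCurve (modCurve P)) (modelCurve_j_eq_algebraMap_jInv P hP)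

/-- **The `SL₂`-clause of [IUTchI] Def. 3.1 (c) for the model, in its own typing** (`ImageContainsSL2` over
`AlgebraicClosure F`: an `𝔽_l`-basis of `E_F[l](F̄)` on which every determinant-one integer matrix is a Galois
element) — the field `BadPlaceInput.imageContainsSL2` / `PlaceInput.imageContainsSL2` of the (P7)-constructor —
from `Cor22.CondP6 P l` (via abc-iut-L5-t12's `imageContainsSL2_of_imageModLContainsSL2`).
[cite: Mochizuki2012, IUTchI Def. 3.1 (c); IUTchIV Cor. 2.2 (ii) (P7) p.46] -/
theorem imageContainsSL2_modelCurve_of_condP6 (hP : P ∈ UP) (hcore : Cor22.AdmitsCore P) {l : ℕ}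
    [Fact l.Prime] (h5 : 5 ≤ l) (h6 : Cor22.CondP6 P l) :
    ImageContainsSL2 (AlgebraicClosure (ThetaF (modCurve P))) (modelCurve (modCurve P)) l :=
  imageContainsSL2_of_imageModLContainsSL2 (modelCurve (modCurve P)) l
    (imageModLContainsSL2_modelCurve_of_condP6 P hP hcore h5 h6)

/-- **(P4) for the model from `Cor22.CondP6`**: under the same hypotheses `E_F = modelCurve (modCurve P)`
admits no `l`-cyclic subgroup scheme (no `Gal(F̄/F)`-stable subgroup of `E_F[l]` of order `l`) — the
hypothesis `hno` of `exists_initialThetaData_of_conditions` (abc-iut-L5-t7), now available inside the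
`∀`-binders of `Cor22.Thm110Legendre`. [cite: Mochizuki2012, IUTchIV Cor. 2.2 (ii) (P4)–(P7) pp.45–46] -/
theorem not_admitsLCyclic_modelCurve_of_condP6 (hP : P ∈ UP) (hcore : Cor22.AdmitsCore P) {l : ℕ}
    [Fact l.Prime] (h5 : 5 ≤ l) (h6 : Cor22.CondP6 P l) :
    ¬ ({ F := ThetaF (modCurve P), W := modelCurve (modCurve P) } : EllPoint).AdmitsLCyclic l :=
  EllPoint.not_admitsLCyclic_of_imageModLContainsSL2 _ l
    (imageModLContainsSL2_modelCurve_of_condP6 P hP hcore h5 h6)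

end Tripod

end Literature.IUT.HodgeTheaters

end
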